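import Literature.MathematicalPhysics.KineticTheory.LangevinChainNESSFromH2
import Literature.MathematicalPhysics.KineticTheory.LangevinChainVariational
import Literature.MathematicalPhysics.KineticTheory.LangevinChainCostate
import Literature.Analysis.Calculus.SubmersionNullPreimage
import Literature.Probability.Process.BrownianSkeleton
import Mathlib.Analysis.Normed.Module.FiniteDimension
import Mathlib.LinearAlgebra.Matrix.ToLinearEquiv
import Mathlib.RingTheory.Noetherian.Basic
import HarnessLib

/-!
# Absolute continuity of the transition probabilities of the pinned chain (no hypoellipticity)

Trunk T-KINETIC (Literature/MathematicalPhysics/KineticTheory). Final file of the second seat of the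
provefact unit for the named fact `CuneoEckmannHairerReyBellet2018_pinnedChain`
(`LangevinChainNESS.lean`; Cuneo–Eckmann–Hairer–Rey-Bellet 2018, Thm 2.13, weak-stationarity
corollary for the pinned anharmonic chain). Everything is PROVED; no named facts are introduced.

## Main results

* `pinnedChain_transitionKernel_one_absolutelyContinuous` — **for the pinned chain
  (`ω₂ > 0`, `lam, β ≥ 0`, `γ, T_L > 0`, `N ≥ 1`) and every initial condition `z`, the transition
  probability `P_1(z, ·)` of the SDE (2.2) (the kernels `OscillatorChain.transitionKernel` of
  `LangevinChainKernel.lean`) is absolutely continuous with respect to Lebesgue measure** — the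
  absolute-continuity half of CEHR Prop. 3.2, printed as a consequence of Hörmander's theorem for
  `∂_t - L`, here proved WITHOUT any hypoellipticity theorem.
* `CuneoEckmannHairerReyBellet2018_pinnedChain_of_H2` — hence (with
  `CuneoEckmannHairerReyBellet2018_pinnedChain_of_H2_of_absolutelyContinuous`,
  `LangevinChainNESSFromH2.lean`) **the named fact follows from the Lyapunov condition H2 alone**
  (CEHR Thm 5.1 / Rem 5.2, named fact `CuneoEckmannHairerReyBellet2018_H2`): the dependence on
  `Literature.Analysis.Distribution.Hormander1967_thm11` of
  `CuneoEckmannHairerReyBellet2018_pinnedChain_of_H2_of_hormander` (`LangevinChainDynkin.lean`) is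
  removed.

## The argument (a finite-dimensional "partial Malliavin calculus" for additive noise)

Fix `z` and a level `m`. By `BrownianSkeleton.lean` the Brownian pair on `[0,1]` is
`B = PL^m(Ξ) + R` with the skeleton `Ξ = pairSkel m` (the `2·2^m` dyadic increments, whose law is
absolutely continuous on `ℝ^{2·2^m}`) INDEPENDENT of the remainder `R = pairRem m`. Since the
noise is additive, the state at time `1` is `Φ₁(z, B) = E_R(Ξ)` where, for every (raw) remainder
`r`, `E_r(x) = chainFlow z (noise(r) + PL-bath-noise(x)) 1` (`skelFlowMap`,
`pinnedChain_solMap_one_eq_skelFlowMap`) is a `C^∞` function of the skeleton `x`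
(`LangevinChainVariational.lean`: `contDiff_skelFlowMap`), with derivative
`D E_r(x) δ = w_δ(1)`, `w_δ` the variational solution. Let `S_m` be the event that
`D E_R(Ξ)` is ONTO phase space (measurable: it is `{det(J Jᵀ) ≠ 0}` for the Jacobian matrix `J`,
whose entries are limits of difference quotients, `measurable_fderiv_skelFlowMap_apply`,
`gramDet`). Then for a Lebesgue-null `B`:

* `P(Φ ∈ B, S_m) = 0`: conditionally on `R = r` this is the Gaussian (hence Lebesgue-dominated)
  measure of `{x : D E_r(x) onto} ∩ E_r⁻¹(B)`, which is Lebesgue-null because submersions pull null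
  sets back to null sets (`Literature/Analysis/Calculus/SubmersionNullPreimage.lean`);
  `measure_pairSkel_pairRem_eq_zero_of_volume` does the conditioning.
* `P(S_m) → 1`: along EVERY Brownian path the ranges of `D E_{R_m}(Ξ_m)` increase with `m`
  (a level-`m` direction refines to a level-`m+1` direction with the same forcing,
  `range_fderiv_skelFlowMap_mono`, `plInterp_refineIncr`), hence stabilise (phase space is
  finite-dimensional, `monotone_stabilizes_iff_noetherian`); if the stable range were proper, a
  nonzero costate `c` (`ċ = -DY(ζ)ᵀ c` along the Brownian trajectory `ζ`, produced by
  `exists_linearODE_solution_of_continuous`) would pair to zero with all variational endpoints,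
  in particular those of the left-bath dyadic tent forcings, so that all dyadic means of its
  left-bath momentum component vanish and `c(1) = 0` (`LangevinChainCostate.lean`:
  `dualPair_costate_one_tent`, `costate_one_eq_zero_of_dyadic` — linearised observability of the
  chain through its left end, `V'' = 1 + 3βr² ≠ 0`), a contradiction
  (`exists_forall_range_fderiv_skelFlowMap_eq_top`).

So `P(Φ ∈ B) ≤ P(S_mᶜ) → 0`.

## References

* N. Cuneo, J.-P. Eckmann, M. Hairer, L. Rey-Bellet, *Non-equilibrium steady states for networks
  of oscillators*, Electron. J. Probab. 23 (2018) no. 55 (arXiv:1712.09413): Thm 2.13, Prop. 3.2,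
  Prop. 4.1. Page numbers refer to the arXiv version.
* J.-M. Bismut, *Martingales, the Malliavin calculus and hypoellipticity under general
  Hörmander's conditions*, Z. Wahrsch. verw. Gebiete 56 (1981) 469–505 (absolute continuity from
  finite-dimensional perturbations of the noise). [folklore]

## Design choices

* Time `1` only (what `LangevinChainNESSFromH2.lean` consumes); the same proof gives every
  `t > 0` after rescaling the dyadic skeleton to `[0, t]`.
* The right bath is not used (`T_R` arbitrary): observability through the left end suffices.
* Surjectivity is encoded by the Gram determinant `det (J Jᵀ) ≠ 0` of the Jacobian matrix in the
  standard coordinates (`jacMat`, `gramMat`; `range_eq_top_of_det_gramMat_ne_zero`,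
  `det_gramMat_ne_zero_of_range_eq_top`), which makes the surjectivity events measurable and
  their skeleton sections open.
-/

noncomputable section

open MeasureTheory Filter Topology Set Function unitInterval Finset
open scoped NNReal ENNReal ContDiff Matrix

namespace Literature.Probability.Process

open KolmogorovChentsov (dyad coe_dyad)

/-! ### Refinement: level-`m` piecewise-linear paths are level-`m+1` piecewise-linear paths -/

/-- Refinement of a skeleton: the level-`m+1` increments of the level-`m` piecewise-linear path
with increments `x` (each increment is split into two halves). [folklore] -/
def refineIncr (m : ℕ) (x : Fin (2 ^ m) → ℝ) : Fin (2 ^ (m + 1)) → ℝ := fun j =>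
  x ⟨j.val / 2, Nat.div_lt_of_lt_mul (by simpa [pow_succ, mul_comm] using j.isLt)⟩ / 2

/-- The level-`m` tent is the average of the two level-`m+1` tents it covers:
`λ^m_k = (λ^{m+1}_{2k} + λ^{m+1}_{2k+1}) / 2`. [folklore] -/
theorem tentCoeff_eq_half_add (m k : ℕ) (u : ℝ≥0) :
    tentCoeff m k u = (tentCoeff (m + 1) (2 * k) u + tentCoeff (m + 1) (2 * k + 1) u) / 2 := by
  unfold tentCoeff
  rw [show 2 * k + 1 + 1 = 2 * (k + 1) by ring, KolmogorovChentsov.dyad_succ_two_mul,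
    KolmogorovChentsov.dyad_succ_two_mul, pow_succ]
  ring

/-- **Refinement identity**: `PL^m_x = PL^{m+1}_{refine x}`. [folklore] -/
theorem plInterp_refineIncr (m : ℕ) (x : Fin (2 ^ m) → ℝ) (u : ℝ≥0) :
    plInterp (m + 1) (refineIncr m x) u = plInterp m x u := by
  unfold plInterp
  -- reindex `Fin (2^(m+1)) ≃ Fin (2^m) × Fin 2`
  have h2 : 2 ^ (m + 1) = 2 ^ m * 2 := pow_succ 2 m
  rw [← Fin.sum_congr' _ h2.symm]
  rw [← Finset.sum_equiv finProdFinEquiv (s := Finset.univ) (t := Finset.univ) (fun _ => by simp)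
    (g := fun j : Fin (2 ^ m * 2) => refineIncr m x (Fin.cast h2.symm j) *
      tentCoeff (m + 1) (Fin.cast h2.symm j) u) (fun _ _ => rfl)]
  rw [Fintype.sum_prod_type]
  refine Finset.sum_congr rfl fun k _ => ?_
  rw [Fin.sum_univ_two, tentCoeff_eq_half_add m k u]
  have hval0 : ((finProdFinEquiv (k, (0 : Fin 2)) : Fin (2 ^ m * 2)) : ℕ) = 2 * k := by
    simp [finProdFinEquiv, Fin.val_mk]
  have hval1 : ((finProdFinEquiv (k, (1 : Fin 2)) : Fin (2 ^ m * 2)) : ℕ) = 2 * k + 1 := by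
    simp [finProdFinEquiv, Fin.val_mk]; ring
  have hr0 : refineIncr m x (Fin.cast h2.symm (finProdFinEquiv (k, (0 : Fin 2)))) = x k / 2 := by
    unfold refineIncr
    congr 2
    apply Fin.ext
    simp only [Fin.val_cast, hval0]
    omega
  have hr1 : refineIncr m x (Fin.cast h2.symm (finProdFinEquiv (k, (1 : Fin 2)))) = x k / 2 := by
    unfold refineIncr
    congr 2
    apply Fin.ext
    simp only [Fin.val_cast, hval1]
    omega
  rw [hr0, hr1]
  simp only [Fin.val_cast, hval0, hval1]
  ring

end Literature.Probability.Process

namespace Literature.MathematicalPhysics.KineticTheory.HeatConduction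

open Literature.Probability.Process OscillatorChain

variable {N : ℕ}

/-! ### The skeleton forcing: piecewise-linear bath noise as a linear map of the skeleton -/

/-- Real time `τ ∈ [0, 1]` as a point of `ℝ≥0`. [folklore] -/
def toNN (τ : I) : ℝ≥0 := ⟨τ, τ.2.1⟩

/-- `toNN` is continuous. [folklore] -/
@[fun_prop] theorem continuous_toNN : Continuous toNN :=
  continuous_subtype_val.subtype_mk _

/-- `toNN τ` has the real value `τ`. [folklore] -/
@[simp] theorem coe_toNN (τ : I) : ((toNN τ : ℝ≥0) : ℝ) = τ := rfl

/-- The **skeleton forcing path** of a skeleton `x` (amplitudes `c_L, c_R`):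
`τ ↦ (i ↦ [i = 0] c_L PL^m_{x₁}(τ) + [i = N-1] c_R PL^m_{x₂}(τ))` on `[0, 1]` — the momentum noise of
the pair of piecewise-linear paths with increments `x`. [folklore] -/
def skelForcingFun (N m : ℕ) (c_L c_R : ℝ) (x : PairSkeleton m) : C(I, Fin N → ℝ) :=
  ⟨fun τ i => (if i.val = 0 then c_L else 0) * plInterp m x.1 (toNN τ) +
      (if i.val = N - 1 then c_R else 0) * plInterp m x.2 (toNN τ),
    continuous_pi fun i => by
      have h1 := (continuous_plInterp m x.1).comp continuous_toNN
      have h2 := (continuous_plInterp m x.2).comp continuous_toNN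
      exact (continuous_const.mul h1).add (continuous_const.mul h2)⟩

/-- Unfolding `skelForcingFun`. [folklore] -/
@[simp] theorem skelForcingFun_apply (N m : ℕ) (c_L c_R : ℝ) (x : PairSkeleton m) (τ : I) (i : Fin N) :
    skelForcingFun N m c_L c_R x τ i = (if i.val = 0 then c_L else 0) * plInterp m x.1 (toNN τ) +
      (if i.val = N - 1 then c_R else 0) * plInterp m x.2 (toNN τ) := rfl

/-- The skeleton forcing is linear in the skeleton; as a continuous linear map
`PairSkeleton m →L C([0,1], ℝ^N)` (finite-dimensional source). [folklore] -/
def skelForcing (N m : ℕ) (c_L c_R : ℝ) : PairSkeleton m →L[ℝ] C(I, Fin N → ℝ) :=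
  LinearMap.toContinuousLinearMap
    { toFun := skelForcingFun N m c_L c_R
      map_add' := fun x y => by
        ext τ i
        simp only [skelForcingFun_apply, Prod.fst_add, Prod.snd_add, plInterp_add,
          ContinuousMap.add_apply, Pi.add_apply]
        ring
      map_smul' := fun c x => by
        ext τ i
        simp only [skelForcingFun_apply, Prod.smul_fst, Prod.smul_snd, plInterp_smul,
          ContinuousMap.smul_apply, Pi.smul_apply, smul_eq_mul, RingHom.id_apply]
        ring }

/-- Unfolding `skelForcing`. [folklore] -/
@[simp] theorem skelForcing_apply (N m : ℕ) (c_L c_R : ℝ) (x : PairSkeleton m) (τ : I) (i : Fin N) :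
    skelForcing N m c_L c_R x τ i = (if i.val = 0 then c_L else 0) * plInterp m x.1 (toNN τ) +
      (if i.val = N - 1 then c_R else 0) * plInterp m x.2 (toNN τ) := rfl

/-- For the standard basis skeleton `(e_k, 0)` the forcing is the left-bath tent:
`(H (e_k, 0)) τ i = [i = 0] c_L λ^m_k(τ)`. [folklore] -/
theorem skelForcing_single_fst (N m : ℕ) (c_L c_R : ℝ) (k : Fin (2 ^ m)) (τ : I) (i : Fin N) :
    skelForcing N m c_L c_R ((Pi.single k 1, 0) : PairSkeleton m) τ i =
      (if i.val = 0 then c_L else 0) * tentCoeff m k (toNN τ) := by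
  rw [skelForcing_apply]
  have h1 : plInterp m (Pi.single k (1 : ℝ)) (toNN τ) = tentCoeff m k (toNN τ) := by
    simp [plInterp, Pi.single_apply]
  have h2 : plInterp m (0 : Fin (2 ^ m) → ℝ) (toNN τ) = 0 := by simp [plInterp]
  simp only [h1, h2, mul_zero, add_zero]

/-- **Bridging lemma** (requested by the review of `LangevinChainCostate.lean`): the real dyadic
nodes `rnode` of the costate file are the `KolmogorovChentsov.dyad` nodes of the skeleton file.
[folklore] -/
theorem rnode_eq_coe_dyad (m k : ℕ) : rnode m k = ((KolmogorovChentsov.dyad m k : ℝ≥0) : ℝ) := by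
  rw [rnode, KolmogorovChentsov.coe_dyad]

/-- **Bridging lemma**: the `ℝ≥0`-time tent coefficient of the skeleton file and the real ramp
`rtent` of the costate file agree on `[0, 1]`. [folklore] -/
theorem tentCoeff_toNN (m k : ℕ) (τ : I) : tentCoeff m k (toNN τ) = rtent m k τ := by
  simp only [tentCoeff, rtent, rnode_eq_coe_dyad, NNReal.coe_min, coe_toNN]

/-- Refining both skeletons does not change the forcing. [folklore] -/
theorem skelForcing_refine (N m : ℕ) (c_L c_R : ℝ) (x : PairSkeleton m) :
    skelForcing N (m + 1) c_L c_R (refineIncr m x.1, refineIncr m x.2) = skelForcing N m c_L c_R x := by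
  ext τ i
  simp only [skelForcing_apply, plInterp_refineIncr]

/-! ### The skeleton flow map -/

section Pinned

variable {ω₂ lam β γ : ℝ} (hω : 0 < ω₂) (hl : 0 ≤ lam) (hβ : 0 ≤ β) (hγ : 0 ≤ γ) (N : ℕ)
  (T_L T_R : ℝ)

/-- The noise amplitudes `√(2γT_L)`, `√(2γT_R)` of the SDE (2.2), as in `OscillatorChain.solMap`.
[folklore] -/
def ampL (ω₂ lam β γ T_L : ℝ) : ℝ := Real.sqrt (2 * (pinnedChain ω₂ lam β γ).γ * T_L)

/-- See `ampL`. [folklore] -/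
def ampR (ω₂ lam β γ T_R : ℝ) : ℝ := Real.sqrt (2 * (pinnedChain ω₂ lam β γ).γ * T_R)

/-- The **skeleton noise**: the bath noise of the remainder pair `r` perturbed by the piecewise-
linear bath noise of the skeleton `x`. [folklore] -/
def skelNoise (ω₂ lam β γ : ℝ) (N : ℕ) (T_L T_R : ℝ) (m : ℕ) (r : WienerPair) (x : PairSkeleton m) :
    ℝ → Fin N → ℝ :=
  perturbedNoise (chainNoise N (ampL ω₂ lam β γ T_L) (ampR ω₂ lam β γ T_R) r)
    (skelForcing N m (ampL ω₂ lam β γ T_L) (ampR ω₂ lam β γ T_R)) x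

/-- The **skeleton flow map** at time `1`: the state at time `1` of the chain started at `z` and
driven by the skeleton noise, as a function of the skeleton `x` (for a fixed remainder `r`).
[folklore] -/
def skelFlowMap (ω₂ lam β γ : ℝ) (N : ℕ) (T_L T_R : ℝ) (m : ℕ) (z : PhaseSpace N) (r : WienerPair)
    (x : PairSkeleton m) : PhaseSpace N :=
  (pinnedChain ω₂ lam β γ).chainFlow N z (skelNoise ω₂ lam β γ N T_L T_R m r x) 1

/-- **On `[0,1]` the Brownian bath noise is the skeleton noise of (skeleton, remainder) of the
path.** [folklore] -/
theorem chainNoise_pairPath_eqOn_skelNoise (ω₂ lam β γ : ℝ) (N : ℕ) (T_L T_R : ℝ) (m : ℕ) (wp : WienerPair) :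
    EqOn (chainNoise N (ampL ω₂ lam β γ T_L) (ampR ω₂ lam β γ T_R) (pairPath wp))
      (skelNoise ω₂ lam β γ N T_L T_R m (pairRem m wp) (pairSkel m wp)) (Icc 0 1) := by
  intro t ht
  have htnn : t.toNNReal = toNN ⟨t, ht⟩ := NNReal.eq (Real.coe_toNNReal t ht.1)
  have hrec := pairRecon_pairSkel_pairRem m wp
  have hB1 : ∀ u, (pairPath wp).1 u = plInterp m (pairSkel m wp).1 u + (pairRem m wp).1 u := fun u => by
    have := congrArg (fun p : WienerPair => p.1 u) hrec
    simpa [pairRecon] using this.symm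
  have hB2 : ∀ u, (pairPath wp).2 u = plInterp m (pairSkel m wp).2 u + (pairRem m wp).2 u := fun u => by
    have := congrArg (fun p : WienerPair => p.2 u) hrec
    simpa [pairRecon] using this.symm
  have hpl0 : ∀ y : Fin (2 ^ m) → ℝ, plInterp m y 0 = 0 := fun y => by simp [plInterp, tentCoeff]
  have hR10 : (pairRem m wp).1 0 = 0 := by
    have h := hB1 0
    rw [hpl0, zero_add] at h
    rw [← h]
    show brownian 0 wp.1 = 0
    rw [brownian_zero]; rfl
  have hR20 : (pairRem m wp).2 0 = 0 := by
    have h := hB2 0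
    rw [hpl0, zero_add] at h
    rw [← h]
    show brownian 0 wp.2 = 0
    rw [brownian_zero]; rfl
  funext i
  rw [skelNoise, perturbedNoise_of_mem _ _ _ ht, Pi.add_apply, chainNoise_pairPath,
    chainNoise_of_continuous _ _ (continuous_pairRem_fst m wp) (continuous_pairRem_snd m wp)]
  simp only [skelForcing_apply, hR10, hR20, sub_zero, htnn]
  have e1 : brownian (toNN ⟨t, ht⟩) wp.1 = (pairPath wp).1 (toNN ⟨t, ht⟩) := rfl
  have e2 : brownian (toNN ⟨t, ht⟩) wp.2 = (pairPath wp).2 (toNN ⟨t, ht⟩) := rfl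
  rw [e1, e2, hB1, hB2]
  ring

include hω hl hβ hγ

omit hω hl hβ hγ in
/-- The remainder's bath noise is continuous (as for every raw pair). [folklore] -/
theorem continuous_chainNoise_rem (ω₂ lam β γ : ℝ) (N : ℕ) (T_L T_R : ℝ) (r : WienerPair) :
    Continuous (chainNoise N (ampL ω₂ lam β γ T_L) (ampR ω₂ lam β γ T_R) r) :=
  continuous_chainNoise _ _ r

/-- **The solution map at time `1` is the skeleton flow map of (skeleton, remainder).**
[folklore] -/
theorem pinnedChain_solMap_one_eq_skelFlowMap (m : ℕ) (z : PhaseSpace N) (wp : WienerPair) :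
    (pinnedChain ω₂ lam β γ).solMap N T_L T_R 1 z (pairPath wp) =
      skelFlowMap ω₂ lam β γ N T_L T_R m z (pairRem m wp) (pairSkel m wp) := by
  have h := pinnedChain_chainFlow_congr hω hl hβ hγ N z (continuous_chainNoise _ _ (pairPath wp))
    (continuous_perturbedNoise (continuous_chainNoise _ _ (pairRem m wp)) _ (pairSkel m wp))
    (chainNoise_pairPath_eqOn_skelNoise ω₂ lam β γ N T_L T_R m wp) (right_mem_Icc.2 zero_le_one)
  exact h

/-- More generally the whole trajectory on `[0, 1]` is the skeleton-noise trajectory.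
[folklore] -/
theorem pinnedChain_solMap_eqOn_skelFlow (m : ℕ) (z : PhaseSpace N) (wp : WienerPair) :
    EqOn (fun t => (pinnedChain ω₂ lam β γ).solMap N T_L T_R t z (pairPath wp))
      (fun t => (pinnedChain ω₂ lam β γ).chainFlow N z (skelNoise ω₂ lam β γ N T_L T_R m (pairRem m wp) (pairSkel m wp)) t)
      (Icc 0 1) := by
  intro t ht
  have h := pinnedChain_chainFlow_congr hω hl hβ hγ N z (continuous_chainNoise _ _ (pairPath wp))
    (continuous_perturbedNoise (continuous_chainNoise _ _ (pairRem m wp)) _ (pairSkel m wp))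
    (chainNoise_pairPath_eqOn_skelNoise ω₂ lam β γ N T_L T_R m wp) ht
  exact h

/-- **The skeleton flow map is `C^∞` in the skeleton**, for every raw remainder. [folklore] -/
theorem contDiff_skelFlowMap (m : ℕ) (z : PhaseSpace N) (r : WienerPair) :
    ContDiff ℝ ∞ (skelFlowMap ω₂ lam β γ N T_L T_R m z r) :=
  contDiff_chainFlow_perturbedNoise_one hω hl hβ hγ N z (continuous_chainNoise _ _ r) _

/-- Its derivative in the direction `δ` is the endpoint of the variational solution. [folklore] -/
theorem fderiv_skelFlowMap_apply (m : ℕ) (z : PhaseSpace N) (r : WienerPair) (x δ : PairSkeleton m) :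
    fderiv ℝ (skelFlowMap ω₂ lam β γ N T_L T_R m z r) x δ =
      pinnedChainVariation hω hl hβ hγ N z (continuous_chainNoise_rem ω₂ lam β γ N T_L T_R r)
        (skelForcing N m (ampL ω₂ lam β γ T_L) (ampR ω₂ lam β γ T_R)) x δ 1 :=
  fderiv_chainFlow_perturbedNoise_one_apply hω hl hβ hγ N z (continuous_chainNoise_rem ω₂ lam β γ N T_L T_R r) _ x δ

/-- **The skeleton flow map is jointly measurable** in (skeleton, remainder). [folklore] -/
theorem measurable_skelFlowMap (m : ℕ) (z : PhaseSpace N) :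
    Measurable fun p : PairSkeleton m × WienerPair => skelFlowMap ω₂ lam β γ N T_L T_R m z p.2 p.1 := by
  have hG : ∀ t, Measurable fun p : PairSkeleton m × WienerPair => skelNoise ω₂ lam β γ N T_L T_R m p.2 p.1 t := by
    intro t
    have h1 : Measurable fun p : PairSkeleton m × WienerPair =>
        chainNoise N (ampL ω₂ lam β γ T_L) (ampR ω₂ lam β γ T_R) p.2 t :=
      (measurable_chainNoise _ _ t).comp measurable_snd
    have h2 : Measurable fun p : PairSkeleton m × WienerPair =>
        IccExtend zero_le_one (skelForcing N m (ampL ω₂ lam β γ T_L) (ampR ω₂ lam β γ T_R) p.1) t := by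
      have hx : Continuous fun x : PairSkeleton m =>
          (skelForcing N m (ampL ω₂ lam β γ T_L) (ampR ω₂ lam β γ T_R) x) (projIcc 0 1 zero_le_one t) :=
        (continuous_eval_const (projIcc 0 1 zero_le_one t)).comp (skelForcing N m _ _).continuous
      exact hx.measurable.comp measurable_fst
    exact h1.add h2
  have h := pinnedChain_measurable_chainFlow hω hl hβ hγ N (X := fun _ : PairSkeleton m × WienerPair => z)
    (G := fun p : PairSkeleton m × WienerPair => skelNoise ω₂ lam β γ N T_L T_R m p.2 p.1) measurable_const
    (fun p => continuous_perturbedNoise (continuous_chainNoise _ _ p.2) _ p.1) hG 1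
  exact h

omit hω hl hβ hγ in
/-- **Directional derivatives of a measurably parametrised family of differentiable maps are
jointly measurable** (pointwise limits of difference quotients). [folklore] -/
theorem measurable_fderiv_apply_of_param {X Ω V : Type*} [NormedAddCommGroup X] [NormedSpace ℝ X]
    [MeasurableSpace X] [BorelSpace X] [NormedAddCommGroup V] [NormedSpace ℝ V] [MeasurableSpace V]
    [BorelSpace V] [SecondCountableTopology V] [MeasurableSpace Ω] (F : X × Ω → V) (hF : Measurable F)
    (hd : ∀ (r : Ω) (x : X), DifferentiableAt ℝ (fun y => F (y, r)) x) (δ : X) :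
    Measurable fun p : X × Ω => fderiv ℝ (fun y => F (y, p.2)) p.1 δ := by
  have hseq : ∀ n : ℕ, Measurable fun p : X × Ω =>
      ((n : ℝ) + 1) • (F (p.1 + ((n : ℝ) + 1)⁻¹ • δ, p.2) - F p) := by
    intro n
    have hm : Measurable fun p : X × Ω => (p.1 + ((n : ℝ) + 1)⁻¹ • δ, p.2) :=
      (measurable_fst.add_const _).prodMk measurable_snd
    exact ((hF.comp hm).sub hF).const_smul _
  refine measurable_of_tendsto_metrizable hseq ?_
  rw [tendsto_pi_nhds]
  intro p
  have hc : Tendsto (fun n : ℕ => ‖((n : ℝ) + 1)‖) atTop atTop := by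
    have : (fun n : ℕ => ‖((n : ℝ) + 1)‖) = fun n : ℕ => (n : ℝ) + 1 := funext fun n =>
      Real.norm_of_nonneg (by positivity)
    rw [this]
    exact tendsto_natCast_atTop_atTop.atTop_add tendsto_const_nhds
  exact (hd p.2 p.1).hasFDerivAt.lim δ hc

/-- **The directional derivatives of the skeleton flow map are jointly measurable.** [folklore] -/
theorem measurable_fderiv_skelFlowMap_apply (m : ℕ) (z : PhaseSpace N) (δ : PairSkeleton m) :
    Measurable fun p : PairSkeleton m × WienerPair => fderiv ℝ (skelFlowMap ω₂ lam β γ N T_L T_R m z p.2) p.1 δ := by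
  have hE := measurable_skelFlowMap hω hl hβ hγ N T_L T_R m z
  have hd : ∀ (r : WienerPair) (x : PairSkeleton m),
      DifferentiableAt ℝ (fun y => skelFlowMap ω₂ lam β γ N T_L T_R m z r y) x := fun r x =>
    (contDiff_skelFlowMap hω hl hβ hγ N T_L T_R m z r).differentiable (by simp) x
  have h := measurable_fderiv_apply_of_param
    (fun p : PairSkeleton m × WienerPair => skelFlowMap ω₂ lam β γ N T_L T_R m z p.2 p.1) hE hd δ
  exact h

/-! ### Uniqueness for the variational equation; monotonicity of the ranges in the level -/

omit hω hl hβ hγ in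
/-- **Uniqueness for the linearised integral equation** `w = φ + ∫₀ A w` on `[0, 1]` (continuous
operator coefficients): two continuous solutions agree on `[0, 1]` (`volterra_unique`).
[folklore] -/
theorem variational_unique {A : ℝ → PhaseSpace N →L[ℝ] PhaseSpace N} (hA : Continuous A)
    {w₁ w₂ φ : ℝ → PhaseSpace N} (h₁c : Continuous w₁) (h₂c : Continuous w₂)
    (h₁ : ∀ τ ∈ Icc (0 : ℝ) 1, w₁ τ = φ τ + ∫ s in (0 : ℝ)..τ, A s (w₁ s))
    (h₂ : ∀ τ ∈ Icc (0 : ℝ) 1, w₂ τ = φ τ + ∫ s in (0 : ℝ)..τ, A s (w₂ s)) :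
    EqOn w₁ w₂ (Icc 0 1) := by
  set Ah : C(I, PhaseSpace N →L[ℝ] PhaseSpace N) := ⟨fun τ => A τ, hA.comp continuous_subtype_val⟩
  set a₁ : C(I, PhaseSpace N) := ⟨fun τ => w₁ τ, h₁c.comp continuous_subtype_val⟩
  set a₂ : C(I, PhaseSpace N) := ⟨fun τ => w₂ τ, h₂c.comp continuous_subtype_val⟩
  have hV : ∀ (a : C(I, PhaseSpace N)) (w : ℝ → PhaseSpace N), (∀ τ : I, a τ = w τ) → ∀ τ : I,
      Literature.Analysis.ODE.volterraCLM Ah a τ = ∫ s in (0 : ℝ)..(τ : ℝ), A s (w s) := by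
    intro a w haw τ
    rw [Literature.Analysis.ODE.volterraCLM_apply]
    refine intervalIntegral.integral_congr fun s hs => ?_
    have hs' : s ∈ Icc (0 : ℝ) 1 := by
      rw [uIcc_of_le τ.2.1] at hs
      exact ⟨hs.1, hs.2.trans τ.2.2⟩
    rw [Literature.Analysis.ODE.IccExtend_applyCLM_of_mem Ah a hs', haw]
    rfl
  set φh : C(I, PhaseSpace N) := a₁ - Literature.Analysis.ODE.volterraCLM Ah a₁ with hφh
  have e₁ : a₁ = φh + Literature.Analysis.ODE.volterraCLM Ah a₁ := by rw [hφh]; abel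
  have e₂ : a₂ = φh + Literature.Analysis.ODE.volterraCLM Ah a₂ := by
    ext τ : 1
    simp only [hφh, ContinuousMap.add_apply, ContinuousMap.sub_apply]
    rw [hV a₁ w₁ (fun _ => rfl) τ, hV a₂ w₂ (fun _ => rfl) τ]
    change w₂ τ = w₁ τ - _ + _
    rw [h₁ τ τ.2, h₂ τ τ.2]
    abel
  have heq := Literature.Analysis.ODE.volterra_unique Ah e₁ e₂
  intro τ hτ
  have := congrArg (fun a : C(I, PhaseSpace N) => a ⟨τ, hτ⟩) heq
  exact this

/-- The linearisation `s ↦ DY(ζ(s))` along the Brownian trajectory. [folklore] -/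
theorem continuous_fderiv_drift_solMap (z : PhaseSpace N) (wp : WienerPair) :
    Continuous fun s => fderiv ℝ ((pinnedChain ω₂ lam β γ).drift N)
      ((pinnedChain ω₂ lam β γ).solMap N T_L T_R s z (pairPath wp)) :=
  ((pinnedChain_contDiff_drift ω₂ lam β γ N (n := ⊤)).continuous_fderiv (by simp)).comp
    (pinnedChain_continuous_solMap hω hl hβ hγ N T_L T_R z (pairPath wp))

/-- **The variational solutions along the Brownian path**: for the skeleton/remainder of `wp` at
level `m`, the variational solution in the direction `δ` solves
`w(τ) = (0, (H δ)(τ)) + ∫₀^τ DY(ζ(s)) w(s) ds` with `ζ` THE Brownian trajectory (independent of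
`m`). [folklore] -/
theorem pinnedChainVariation_eq_solMap (m : ℕ) (z : PhaseSpace N) (wp : WienerPair) (δ : PairSkeleton m)
    {τ : ℝ} (hτ : τ ∈ Icc (0 : ℝ) 1) :
    pinnedChainVariation hω hl hβ hγ N z (continuous_chainNoise_rem ω₂ lam β γ N T_L T_R (pairRem m wp))
        (skelForcing N m (ampL ω₂ lam β γ T_L) (ampR ω₂ lam β γ T_R)) (pairSkel m wp) δ τ =
      (((0 : Fin N → ℝ), skelForcing N m (ampL ω₂ lam β γ T_L) (ampR ω₂ lam β γ T_R) δ ⟨τ, hτ⟩) :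
          PhaseSpace N) +
        ∫ s in (0 : ℝ)..τ, fderiv ℝ ((pinnedChain ω₂ lam β γ).drift N)
          ((pinnedChain ω₂ lam β γ).solMap N T_L T_R s z (pairPath wp))
          (pinnedChainVariation hω hl hβ hγ N z (continuous_chainNoise_rem ω₂ lam β γ N T_L T_R (pairRem m wp))
            (skelForcing N m (ampL ω₂ lam β γ T_L) (ampR ω₂ lam β γ T_R)) (pairSkel m wp) δ s) := by
  rw [pinnedChainVariation_eq hω hl hβ hγ N z _ _ (pairSkel m wp) δ hτ]
  congr 1
  refine intervalIntegral.integral_congr fun s hs => ?_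
  have hs' : s ∈ Icc (0 : ℝ) 1 := by
    rw [uIcc_of_le hτ.1] at hs
    exact ⟨hs.1, hs.2.trans hτ.2⟩
  simp only [pinnedChain_solMap_eqOn_skelFlow hω hl hβ hγ N T_L T_R m z wp hs']
  rfl

/-- **The ranges of the skeleton derivatives increase with the level** (a level-`m` direction
refines to a level-`m+1` direction with the same forcing, hence the same variational solution).
[folklore] -/
theorem range_fderiv_skelFlowMap_mono (z : PhaseSpace N) (wp : WienerPair) (m : ℕ) :
    LinearMap.range (fderiv ℝ (skelFlowMap ω₂ lam β γ N T_L T_R m z (pairRem m wp)) (pairSkel m wp) :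
        PairSkeleton m →ₗ[ℝ] PhaseSpace N) ≤
      LinearMap.range (fderiv ℝ (skelFlowMap ω₂ lam β γ N T_L T_R (m + 1) z (pairRem (m + 1) wp)) (pairSkel (m + 1) wp) :
        PairSkeleton (m + 1) →ₗ[ℝ] PhaseSpace N) := by
  rintro v ⟨δ, rfl⟩
  refine ⟨(refineIncr m δ.1, refineIncr m δ.2), ?_⟩
  change fderiv ℝ (skelFlowMap ω₂ lam β γ N T_L T_R (m + 1) z (pairRem (m + 1) wp)) (pairSkel (m + 1) wp)
      (refineIncr m δ.1, refineIncr m δ.2) = fderiv ℝ (skelFlowMap ω₂ lam β γ N T_L T_R m z (pairRem m wp)) (pairSkel m wp) δ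
  rw [fderiv_skelFlowMap_apply hω hl hβ hγ, fderiv_skelFlowMap_apply hω hl hβ hγ]
  refine variational_unique N (continuous_fderiv_drift_solMap hω hl hβ hγ N T_L T_R z wp)
    (continuous_pinnedChainVariation hω hl hβ hγ N z _ _ _ _)
    (continuous_pinnedChainVariation hω hl hβ hγ N z _ _ _ _)
    (φ := fun τ => (((0 : Fin N → ℝ), IccExtend zero_le_one
      (skelForcing N m (ampL ω₂ lam β γ T_L) (ampR ω₂ lam β γ T_R) δ) τ) : PhaseSpace N))
    (fun τ hτ => ?_) (fun τ hτ => ?_) (right_mem_Icc.2 zero_le_one)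
  · rw [pinnedChainVariation_eq_solMap hω hl hβ hγ N T_L T_R (m + 1) z wp _ hτ, skelForcing_refine,
      IccExtend_of_mem _ _ hτ]
  · rw [pinnedChainVariation_eq_solMap hω hl hβ hγ N T_L T_R m z wp δ hτ, IccExtend_of_mem _ _ hτ]

/-- The ranges, as an increasing sequence of subspaces of phase space. [folklore] -/
def rangeSeq (z : PhaseSpace N) (wp : WienerPair) : ℕ →o Submodule ℝ (PhaseSpace N) where
  toFun m := LinearMap.range (fderiv ℝ (skelFlowMap ω₂ lam β γ N T_L T_R m z (pairRem m wp)) (pairSkel m wp) :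
    PairSkeleton m →ₗ[ℝ] PhaseSpace N)
  monotone' := monotone_nat_of_le_succ (range_fderiv_skelFlowMap_mono hω hl hβ hγ N T_L T_R z wp)

/-! ### The costate along the Brownian trajectory; surjectivity for large levels -/

omit hω hl hβ hγ in
/-- The costate field is linear in the costate. [folklore] -/
def coDriftLinear (ω₂ lam β γ : ℝ) (N : ℕ) (x : PhaseSpace N) : PhaseSpace N →L[ℝ] PhaseSpace N :=
  LinearMap.toContinuousLinearMap
    { toFun := (pinnedChain ω₂ lam β γ).coDrift N x
      map_add' := fun c d => by
        refine Prod.ext (funext fun j => ?_) (funext fun i => ?_)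
        · simp only [OscillatorChain.coDrift, Prod.snd_add, Prod.fst_add, Pi.add_apply, add_mul,
            sum_add_distrib]
        · simp only [OscillatorChain.coDrift, Prod.snd_add, Prod.fst_add, Pi.add_apply]
          ring
      map_smul' := fun r c => by
        refine Prod.ext (funext fun j => ?_) (funext fun i => ?_)
        · simp only [OscillatorChain.coDrift, Prod.smul_snd, Prod.smul_fst, Pi.smul_apply, smul_eq_mul,
            RingHom.id_apply, mul_sum]
          exact sum_congr rfl fun i _ => by ring
        · simp only [OscillatorChain.coDrift, Prod.smul_snd, Prod.smul_fst, Pi.smul_apply, smul_eq_mul,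
            RingHom.id_apply]
          ring }

omit hω hl hβ hγ in
/-- Unfolding `coDriftLinear`. [folklore] -/
@[simp] theorem coDriftLinear_apply (ω₂ lam β γ : ℝ) (x c : PhaseSpace N) :
    coDriftLinear ω₂ lam β γ N x c = (pinnedChain ω₂ lam β γ).coDrift N x c := rfl

omit hω hl hβ hγ in
/-- The Hessian entries of the pinned chain are continuous functions of the positions. [folklore] -/
theorem continuous_hessPotential_pinned (i j : Fin N) :
    Continuous fun q : Fin N → ℝ => (pinnedChain ω₂ lam β γ).hessPotential N i j q := by
  have hU2 : ContDiff ℝ ∞ (deriv (deriv (pinnedChain ω₂ lam β γ).U)) :=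
    (pinnedChain_contDiff_U ω₂ lam β γ (n := ∞)).iterate_deriv 2
  have hV2 : ContDiff ℝ ∞ (deriv (deriv (pinnedChain ω₂ lam β γ).V)) :=
    (pinnedChain_contDiff_V ω₂ lam β γ (n := ∞)).iterate_deriv 2
  have hU2c := hU2.continuous
  have hV2c := hV2.continuous
  unfold OscillatorChain.hessPotential
  refine ((hU2c.comp (continuous_apply i)).mul continuous_const).add
    (continuous_finsetSum _ fun k _ => continuous_finsetSum _ fun l _ => ?_)
  by_cases h : l.val = k.val + 1
  · simp only [h, if_true]
    exact ((hV2c.comp ((continuous_apply l).sub (continuous_apply k))).mul continuous_const).mul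
      continuous_const
  · simp only [h, if_false]
    exact continuous_const

/-- The costate coefficients `s ↦ G(ζ(s))` along the Brownian trajectory are continuous in
operator norm. [folklore] -/
theorem continuous_coDriftLinear_solMap (z : PhaseSpace N) (wp : WienerPair) :
    Continuous fun s => coDriftLinear ω₂ lam β γ N
      ((pinnedChain ω₂ lam β γ).solMap N T_L T_R s z (pairPath wp)) := by
  have hζ := pinnedChain_continuous_solMap hω hl hβ hγ N T_L T_R z (pairPath wp)
  refine continuous_clm_apply.2 fun c => ?_
  change Continuous fun s =>
    ((fun j => ∑ i, c.2 i * (pinnedChain ω₂ lam β γ).hessPotential N i j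
        ((pinnedChain ω₂ lam β γ).solMap N T_L T_R s z (pairPath wp)).1,
      fun i => -c.1 i + (pinnedChain ω₂ lam β γ).γ * bathWeight N i * c.2 i) : PhaseSpace N)
  refine Continuous.prodMk (continuous_pi fun j => ?_) (continuous_pi fun i => ?_)
  · exact continuous_finsetSum _ fun i _ => continuous_const.mul
      ((continuous_hessPotential_pinned (ω₂ := ω₂) (lam := lam) (β := β) (γ := γ) N i j).comp
        (continuous_fst.comp hζ))
  · exact continuous_const

omit hω hl hβ hγ in
/-- `V'' = 1 + 3βr² ≠ 0` for `β ≥ 0`. [folklore] -/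
theorem pinnedChain_deriv_deriv_V_ne_zero (hβ : 0 ≤ β) (r : ℝ) :
    deriv (deriv (pinnedChain ω₂ lam β γ).V) r ≠ 0 := by
  rw [pinnedChain_deriv_deriv_V]
  positivity

/-- **Along every Brownian trajectory the skeleton derivative is onto phase space for all large
levels.** Otherwise, the ranges (increasing, hence eventually constant) miss a nonzero costate
direction `c₁`; the costate `c` with `c(1) = c₁` pairs to zero with every variational endpoint,
in particular with those of the left-bath tent forcings, so the dyadic means of its left-bath
momentum component vanish (`dualPair_costate_one_tent`) and `c(1) = 0`
(`costate_one_eq_zero_of_dyadic`), a contradiction. Needs `γ T_L > 0` (the left bath is on) and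
`N ≥ 1`. [folklore] -/
theorem exists_forall_range_fderiv_skelFlowMap_eq_top (hγ' : 0 < γ) (hL : 0 < T_L) (hN : 0 < N)
    (z : PhaseSpace N) (wp : WienerPair) :
    ∃ m₀ : ℕ, ∀ m, m₀ ≤ m →
      LinearMap.range (fderiv ℝ (skelFlowMap ω₂ lam β γ N T_L T_R m z (pairRem m wp)) (pairSkel m wp) :
        PairSkeleton m →ₗ[ℝ] PhaseSpace N) = ⊤ := by
  set P := pinnedChain ω₂ lam β γ with hP
  set f := rangeSeq hω hl hβ hγ N T_L T_R z wp with hf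
  obtain ⟨m₀, hm₀⟩ := monotone_stabilizes_iff_noetherian.2 inferInstance f
  have hfm : ∀ m, (f m : Submodule ℝ (PhaseSpace N)) =
      LinearMap.range (fderiv ℝ (skelFlowMap ω₂ lam β γ N T_L T_R m z (pairRem m wp)) (pairSkel m wp) :
        PairSkeleton m →ₗ[ℝ] PhaseSpace N) := fun m => rfl
  suffices htop : f m₀ = ⊤ by
    refine ⟨m₀, fun m hm => ?_⟩
    rw [← hfm, ← hm₀ m hm, htop]
  by_contra hne
  obtain ⟨c₁, hc₁, hann⟩ := exists_dualPair_eq_zero_of_ne_top hne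
  have hall : ∀ m, ∀ v ∈ f m, dualPair c₁ v = 0 := fun m v hv =>
    hann v (by rw [hm₀ (max m m₀) (le_max_right _ _)]; exact f.monotone (le_max_left _ _) hv)
  -- the Brownian trajectory and its costate
  set ζ : ℝ → PhaseSpace N := fun s => P.solMap N T_L T_R s z (pairPath wp) with hζ
  have hζc : Continuous ζ := pinnedChain_continuous_solMap hω hl hβ hγ N T_L T_R z (pairPath wp)
  obtain ⟨c, hc1, hcd⟩ := exists_linearODE_solution_of_continuous
    (fun s => coDriftLinear ω₂ lam β γ N (ζ s))
    (continuous_coDriftLinear_solMap hω hl hβ hγ N T_L T_R z wp) 1 c₁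
  have hcc : ContinuousOn c (Icc 0 1) :=
    (continuous_iff_continuousAt.2 fun t => (hcd t).continuousAt).continuousOn
  have hcd' : ∀ s ∈ Ioo (0 : ℝ) 1, HasDerivAt c (P.coDrift N (ζ s) (c s)) s := fun s _ => hcd s
  -- vanishing dyadic means of the left-bath momentum component
  have hcL : ampL ω₂ lam β γ T_L ≠ 0 := by
    unfold ampL
    have : (pinnedChain ω₂ lam β γ).γ = γ := rfl
    rw [this]
    positivity
  have hmeans : ∀ m k : ℕ, k < 2 ^ m → ∫ s in rnode m k..rnode m (k + 1), (c s).2 ⟨0, hN⟩ = 0 := by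
    intro m k hk
    set kk : Fin (2 ^ m) := ⟨k, hk⟩ with hkk'
    have hkk : (kk : ℕ) = k := rfl
    set δ : PairSkeleton m := (Pi.single kk 1, 0)
    set W := pinnedChainVariation hω hl hβ hγ N z
      (continuous_chainNoise_rem ω₂ lam β γ N T_L T_R (pairRem m wp))
      (skelForcing N m (ampL ω₂ lam β γ T_L) (ampR ω₂ lam β γ T_R)) (pairSkel m wp) δ with hW
    have hW1 : dualPair c₁ (W 1) = 0 := by
      refine hall m _ ⟨δ, ?_⟩
      exact fderiv_skelFlowMap_apply hω hl hβ hγ N T_L T_R m z (pairRem m wp) (pairSkel m wp) δ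
    have hWeq : ∀ τ ∈ Icc (0 : ℝ) 1, W τ = ((0 : Fin N → ℝ), fun i : Fin N =>
        if i = ⟨0, hN⟩ then ampL ω₂ lam β γ T_L * rtent m k τ else 0) +
        ∫ s in (0 : ℝ)..τ, fderiv ℝ (P.drift N) (ζ s) (W s) := by
      intro τ hτ
      rw [hW, pinnedChainVariation_eq_solMap hω hl hβ hγ N T_L T_R m z wp δ hτ]
      congr 2
      funext i
      rw [skelForcing_single_fst, tentCoeff_toNN]
      by_cases hi : i = ⟨0, hN⟩
      · subst hi; simp [hkk]
      · have : i.val ≠ 0 := fun h => hi (Fin.ext h)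
        simp [hi, this]
    have htent := OscillatorChain.dualPair_costate_one_tent (pinnedChain_contDiff_U ω₂ lam β γ)
      (pinnedChain_contDiff_V ω₂ lam β γ) hζc
      (continuous_pinnedChainVariation hω hl hβ hγ N z _ _ (pairSkel m wp) δ) hcc hcd' ⟨0, hN⟩
      (ampL ω₂ lam β γ T_L) hk hWeq
    rw [hc1, hW1] at htent
    have h2 : (ampL ω₂ lam β γ T_L * 2 ^ m : ℝ) ≠ 0 := mul_ne_zero hcL (by positivity)
    have := mul_eq_zero.1 htent.symm
    rcases this with h | h
    · exact absurd h h2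
    · exact h
  have hc10 := OscillatorChain.costate_one_eq_zero_of_dyadic
    (pinnedChain_deriv_deriv_V_ne_zero (ω₂ := ω₂) (lam := lam) (γ := γ) hβ) hN hcc hcd' hmeans
  rw [hc1] at hc10
  exact hc₁ hc10

end Pinned

/-! ### Coordinates, the Jacobian matrix and its Gram determinant -/

section Gram

variable (N) (m : ℕ)

/-- Coordinates of phase space indexed by `Fin N ⊕ Fin N` (positions, momenta). [folklore] -/
def coordV (v : PhaseSpace N) : Fin N ⊕ Fin N → ℝ := fun a => Sum.elim v.1 v.2 a

/-- The phase-space vector with given coordinates. [folklore] -/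
def ofCoordV (g : Fin N ⊕ Fin N → ℝ) : PhaseSpace N := (fun i => g (Sum.inl i), fun i => g (Sum.inr i))

/-- `coordV ∘ ofCoordV = id`. [folklore] -/
@[simp] theorem coordV_ofCoordV (g : Fin N ⊕ Fin N → ℝ) : coordV N (ofCoordV N g) = g := by
  funext a; cases a <;> rfl

/-- `ofCoordV ∘ coordV = id`. [folklore] -/
@[simp] theorem ofCoordV_coordV (v : PhaseSpace N) : ofCoordV N (coordV N v) = v := rfl

/-- The zero vector has zero coordinates. [folklore] -/
@[simp] theorem coordV_zero : coordV N (0 : PhaseSpace N) = 0 := by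
  funext a; cases a <;> rfl

/-- Coordinates determine the vector. [folklore] -/
theorem coordV_injective : Function.Injective (coordV N) := fun v w h => by
  rw [← ofCoordV_coordV N v, ← ofCoordV_coordV N w, h]

/-- The pairing is the dot product of coordinates. [folklore] -/
theorem dualPair_eq_dotProduct (c v : PhaseSpace N) : dualPair c v = coordV N c ⬝ᵥ coordV N v := by
  simp [dualPair, coordV, dotProduct, Fintype.sum_sum_type]

/-- The standard basis of the skeleton space, indexed by `Fin 2^m ⊕ Fin 2^m`. [folklore] -/
def basisX (j : Fin (2 ^ m) ⊕ Fin (2 ^ m)) : PairSkeleton m :=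
  Sum.elim (fun k => ((Pi.single k 1, 0) : PairSkeleton m)) (fun k => ((0, Pi.single k 1) : PairSkeleton m)) j

/-- Coordinates of a skeleton. [folklore] -/
def coordX (x : PairSkeleton m) : Fin (2 ^ m) ⊕ Fin (2 ^ m) → ℝ := fun j => Sum.elim x.1 x.2 j

/-- Expansion of a skeleton in the standard basis. [folklore] -/
theorem sum_coordX_smul_basisX (x : PairSkeleton m) : ∑ j, coordX m x j • basisX m j = x := by
  rw [Fintype.sum_sum_type]
  ext k
  · simp [coordX, basisX, Prod.fst_sum, Finset.sum_apply, Pi.single_apply]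
  · simp [coordX, basisX, Prod.snd_sum, Finset.sum_apply, Pi.single_apply]

variable {N m}

/-- The Jacobian matrix of a linear map `L : skeletons → phase space` in coordinates. [folklore] -/
def jacMat (L : PairSkeleton m →ₗ[ℝ] PhaseSpace N) : Matrix (Fin N ⊕ Fin N) (Fin (2 ^ m) ⊕ Fin (2 ^ m)) ℝ :=
  fun a j => coordV N (L (basisX m j)) a

/-- Its Gram matrix `J Jᵀ`. [folklore] -/
def gramMat (L : PairSkeleton m →ₗ[ℝ] PhaseSpace N) : Matrix (Fin N ⊕ Fin N) (Fin N ⊕ Fin N) ℝ :=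
  jacMat L * (jacMat L)ᵀ

/-- `(γ ᵥ* J)_j = ⟨c, L b_j⟩` for `γ` the coordinates of `c`. [folklore] -/
theorem coordV_vecMul_jacMat (L : PairSkeleton m →ₗ[ℝ] PhaseSpace N) (c : PhaseSpace N)
    (j : Fin (2 ^ m) ⊕ Fin (2 ^ m)) : (coordV N c ᵥ* jacMat L) j = dualPair c (L (basisX m j)) := by
  simp [Matrix.vecMul, jacMat, dualPair_eq_dotProduct, dotProduct, Fintype.sum_sum_type]

/-- A vector pairing to zero with the images of the basis pairs to zero with the whole range.
[folklore] -/
theorem dualPair_eq_zero_of_basisX (L : PairSkeleton m →ₗ[ℝ] PhaseSpace N) {c : PhaseSpace N}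
    (h : ∀ j, dualPair c (L (basisX m j)) = 0) (x : PairSkeleton m) : dualPair c (L x) = 0 := by
  rw [← sum_coordX_smul_basisX m x, map_sum]
  have : ∀ j, dualPair c (L (coordX m x j • basisX m j)) = 0 := fun j => by
    rw [map_smul, dualPair_smul_right, h j, mul_zero]
  -- additivity over the finite sum
  have hadd : ∀ (s : Finset (Fin (2 ^ m) ⊕ Fin (2 ^ m))),
      dualPair c (∑ j ∈ s, L (coordX m x j • basisX m j)) = 0 := by
    intro s
    induction s using Finset.induction_on with
    | empty => simp [dualPair]
    | insert j s hj ih => rw [Finset.sum_insert hj, dualPair_add_right, this j, ih, zero_add]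
  exact hadd _

/-- **Nonzero Gram determinant means onto.** [folklore] -/
theorem range_eq_top_of_det_gramMat_ne_zero (L : PairSkeleton m →ₗ[ℝ] PhaseSpace N)
    (h : (gramMat L).det ≠ 0) : LinearMap.range L = ⊤ := by
  by_contra hne
  obtain ⟨c, hc, hann⟩ := exists_dualPair_eq_zero_of_ne_top hne
  apply h
  rw [← Matrix.exists_vecMul_eq_zero_iff]
  refine ⟨coordV N c, fun h0 => hc (coordV_injective N (by rw [h0, coordV_zero])), ?_⟩
  have hJ : coordV N c ᵥ* jacMat L = 0 := by
    funext j
    rw [coordV_vecMul_jacMat, Pi.zero_apply]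
    exact hann _ ⟨_, rfl⟩
  rw [gramMat, ← Matrix.vecMul_vecMul, hJ, Matrix.zero_vecMul]

/-- **Onto means nonzero Gram determinant.** [folklore] -/
theorem det_gramMat_ne_zero_of_range_eq_top (L : PairSkeleton m →ₗ[ℝ] PhaseSpace N)
    (h : LinearMap.range L = ⊤) : (gramMat L).det ≠ 0 := by
  intro hdet
  obtain ⟨g, hg, hg0⟩ := Matrix.exists_vecMul_eq_zero_iff.2 hdet
  -- `‖g J‖² = g (J Jᵀ) · g = 0`
  set u := g ᵥ* jacMat L with hu
  have hu0 : u ⬝ᵥ u = 0 := by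
    have : (g ᵥ* gramMat L) ⬝ᵥ g = 0 := by rw [hg0]; simp
    rw [gramMat, ← Matrix.vecMul_vecMul, Matrix.vecMul_transpose, dotProduct_comm,
      Matrix.dotProduct_mulVec] at this
    exact this
  have huz : u = 0 := dotProduct_self_eq_zero.1 hu0
  -- the vector with coordinates `g` annihilates the range, hence vanishes
  set c := ofCoordV N g with hc
  have hcg : coordV N c = g := coordV_ofCoordV N g
  have hbasis : ∀ j, dualPair c (L (basisX m j)) = 0 := fun j => by
    rw [← coordV_vecMul_jacMat, hcg, ← hu, huz, Pi.zero_apply]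
  have hall : ∀ v, dualPair c v = 0 := fun v => by
    obtain ⟨x, rfl⟩ : v ∈ LinearMap.range L := by rw [h]; trivial
    exact dualPair_eq_zero_of_basisX L hbasis x
  have hc0 : c = 0 := eq_zero_of_forall_dualPair_eq_zero hall
  apply hg
  rw [← hcg, hc0, coordV_zero]

end Gram

/-! ### Assembly: absolute continuity of `P_1(z, ·)` -/

section Assembly

variable {ω₂ lam β γ : ℝ} (hω : 0 < ω₂) (hl : 0 ≤ lam) (hβ : 0 ≤ β) (hγ : 0 ≤ γ) (N : ℕ)
  (T_L T_R : ℝ)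

/-- `Matrix m n ℝ` carries the product (Borel) measurable structure of `m → n → ℝ` (local
instances: `Matrix` is a type synonym without measurable-space instances in Mathlib). [folklore] -/
local instance matrixMeasurableSpace {ι κ : Type} [Fintype ι] [Fintype κ] : MeasurableSpace (Matrix ι κ ℝ) :=
  inferInstanceAs (MeasurableSpace (ι → κ → ℝ))

/-- See `matrixMeasurableSpace`: the structure is Borel for the product topology of `Matrix`.
[folklore] -/
local instance matrixBorelSpace {ι κ : Type} [Fintype ι] [Fintype κ] : BorelSpace (Matrix ι κ ℝ) :=
  inferInstanceAs (BorelSpace (ι → κ → ℝ))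

/-- The Gram determinant of the skeleton derivative, as a function of (skeleton, remainder).
[folklore] -/
def gramDet (ω₂ lam β γ : ℝ) (N : ℕ) (T_L T_R : ℝ) (m : ℕ) (z : PhaseSpace N)
    (p : PairSkeleton m × WienerPair) : ℝ :=
  (gramMat (fderiv ℝ (skelFlowMap ω₂ lam β γ N T_L T_R m z p.2) p.1 : PairSkeleton m →ₗ[ℝ] PhaseSpace N)).det

include hω hl hβ hγ

/-- The Gram determinant is jointly measurable. [folklore] -/
theorem measurable_gramDet (m : ℕ) (z : PhaseSpace N) :
    Measurable (gramDet ω₂ lam β γ N T_L T_R m z) := by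
  have hJ : Measurable fun p : PairSkeleton m × WienerPair =>
      jacMat (fderiv ℝ (skelFlowMap ω₂ lam β γ N T_L T_R m z p.2) p.1 : PairSkeleton m →ₗ[ℝ] PhaseSpace N) := by
    refine measurable_pi_iff.2 fun a => measurable_pi_iff.2 fun j => ?_
    have h := measurable_fderiv_skelFlowMap_apply hω hl hβ hγ N T_L T_R m z (basisX m j)
    have hc : Measurable fun v : PhaseSpace N => coordV N v a := by
      cases a with
      | inl i => exact (measurable_pi_apply i).comp measurable_fst
      | inr i => exact (measurable_pi_apply i).comp measurable_snd
    exact hc.comp h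
  have hG : Measurable fun p : PairSkeleton m × WienerPair =>
      gramMat (fderiv ℝ (skelFlowMap ω₂ lam β γ N T_L T_R m z p.2) p.1 : PairSkeleton m →ₗ[ℝ] PhaseSpace N) := by
    unfold gramMat
    exact (continuous_id.matrix_mul continuous_id.matrix_transpose).measurable.comp hJ
  exact (continuous_id.matrix_det).measurable.comp hG

/-- For a fixed remainder, the Gram determinant is continuous in the skeleton (the skeleton flow
map is `C¹`). [folklore] -/
theorem continuous_gramDet_left (m : ℕ) (z : PhaseSpace N) (r : WienerPair) :
    Continuous fun x : PairSkeleton m =>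
      gramDet ω₂ lam β γ N T_L T_R m z (x, r) := by
  have hD : Continuous fun x : PairSkeleton m => fderiv ℝ (skelFlowMap ω₂ lam β γ N T_L T_R m z r) x :=
    (contDiff_skelFlowMap hω hl hβ hγ N T_L T_R m z r).continuous_fderiv (by simp)
  have hJ : Continuous fun x : PairSkeleton m =>
      jacMat (fderiv ℝ (skelFlowMap ω₂ lam β γ N T_L T_R m z r) x : PairSkeleton m →ₗ[ℝ] PhaseSpace N) := by
    refine continuous_pi fun a => continuous_pi fun j => ?_
    have h : Continuous fun x : PairSkeleton m => fderiv ℝ (skelFlowMap ω₂ lam β γ N T_L T_R m z r) x (basisX m j) :=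
      hD.clm_apply continuous_const
    have hc : Continuous fun v : PhaseSpace N => coordV N v a := by
      cases a with
      | inl i => exact (continuous_apply i).comp continuous_fst
      | inr i => exact (continuous_apply i).comp continuous_snd
    exact hc.comp h
  unfold gramDet gramMat
  exact (hJ.matrix_mul hJ.matrix_transpose).matrix_det

omit hω hl hβ hγ in
/-- Lebesgue measure on the skeleton space is an additive Haar measure. [folklore] -/
theorem isAddHaarMeasure_volume_pairSkeleton (m : ℕ) :
    (volume : Measure (PairSkeleton m)).IsAddHaarMeasure :=
  Measure.prod.instIsAddHaarMeasure _ _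

/-- **For every remainder, the set of skeletons where the skeleton flow map is a submersion AND
lands in a Lebesgue-null set is Lebesgue-null** (submersions pull null sets back to null sets,
`measure_inter_preimage_null_of_submersion`). [folklore] -/
theorem volume_gramDet_ne_inter_preimage_eq_zero (m : ℕ) (z : PhaseSpace N) (r : WienerPair)
    {B : Set (PhaseSpace N)} (hB0 : volume B = 0) :
    volume ({x : PairSkeleton m | gramDet ω₂ lam β γ N T_L T_R m z (x, r) ≠ 0} ∩
      skelFlowMap ω₂ lam β γ N T_L T_R m z r ⁻¹' B) = 0 := by
  haveI := isAddHaarMeasure_volume_pairSkeleton m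
  haveI := isAddHaarMeasure_volume_phaseSpace N
  have hU : IsOpen {x : PairSkeleton m | gramDet ω₂ lam β γ N T_L T_R m z (x, r) ≠ 0} :=
    isOpen_ne_fun (continuous_gramDet_left hω hl hβ hγ N T_L T_R m z r) continuous_const
  refine Literature.Analysis.Calculus.measure_inter_preimage_null_of_submersion volume volume hU
    ((contDiff_skelFlowMap hω hl hβ hγ N T_L T_R m z r).of_le (by exact_mod_cast le_top)).contDiffOn
    (fun x hx => ?_) hB0
  exact range_eq_top_of_det_gramMat_ne_zero _ hx

/-- **Absolute continuity of the transition probability `P_1(z, ·)` of the pinned chain** with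
respect to Lebesgue measure on phase space, for every initial condition `z` (`ω₂ > 0`,
`lam, β ≥ 0`, `γ, T_L > 0`, `N ≥ 1`; no hypoellipticity theorem is used): for a null `B`,
`P(Φ₁(z,B·) ∈ B) ≤ P(S_mᶜ) + P(Φ ∈ B, S_m)` where `S_m` is the event that the skeleton derivative
of level `m` is onto; the second term vanishes by conditioning on the bridges
(`measure_pairSkel_pairRem_eq_zero_of_volume` with the submersion lemma), and `P(S_m) → 1`
because along every path the derivative is onto for all large `m`
(`exists_forall_range_fderiv_skelFlowMap_eq_top`). This is the absolute-continuity part of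
CEHR Prop. 3.2, here by a finite-dimensional Malliavin-type argument.
[cite: CuneoEckmannHairerReyBellet2018, Prop 3.2] -/
theorem pinnedChain_transitionKernel_one_absolutelyContinuous (hγ' : 0 < γ) (hL : 0 < T_L) (hN : 0 < N)
    (z : PhaseSpace N) :
    (pinnedChain ω₂ lam β γ).transitionKernel N T_L T_R 1 z ≪ (volume : Measure (PhaseSpace N)) := by
  refine Measure.AbsolutelyContinuous.mk fun B hB hB0 => ?_
  rw [pinnedChain_transitionKernel_apply' hω hl hβ hγ N T_L T_R 1 z hB, NNReal.coe_one]
  set Φ : WienerPair → PhaseSpace N := fun wp => (pinnedChain ω₂ lam β γ).solMap N T_L T_R 1 z (pairPath wp)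
    with hΦ
  -- the surjectivity events
  set G : (m : ℕ) → Set (PairSkeleton m × WienerPair) := fun m =>
    {p | gramDet ω₂ lam β γ N T_L T_R m z p ≠ 0} with hG
  have hGm : ∀ m, MeasurableSet (G m) := fun m =>
    (measurable_gramDet hω hl hβ hγ N T_L T_R m z) (measurableSet_singleton 0).compl
  set S : ℕ → Set WienerPair := fun m => {wp | (pairSkel m wp, pairRem m wp) ∈ G m} with hS
  have hSm : ∀ m, MeasurableSet (S m) := fun m =>
    ((measurable_pairSkel m).prodMk (measurable_pairRem m)) (hGm m)
  set T : ℕ → Set WienerPair := fun m => ⋂ n, ⋂ (_ : m ≤ n), S n with hT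
  have hTm : ∀ m, MeasurableSet (T m) := fun m =>
    MeasurableSet.iInter fun n => MeasurableSet.iInter fun _ => hSm n
  have hTmono : Monotone T := fun m m' hmm' wp hω => by
    simp only [hT, mem_iInter] at hω ⊢
    exact fun n hn => hω n (hmm'.trans hn)
  have hTS : ∀ m, T m ⊆ S m := fun m wp hω => by
    simp only [hT, mem_iInter] at hω
    exact hω m le_rfl
  -- every path is eventually in `S`
  have hTuniv : (⋃ m, T m) = univ := by
    refine eq_univ_of_forall fun wp => ?_
    obtain ⟨m₀, hm₀⟩ := exists_forall_range_fderiv_skelFlowMap_eq_top hω hl hβ hγ N T_L T_R hγ' hL hN z wp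
    refine mem_iUnion.2 ⟨m₀, ?_⟩
    simp only [hT, mem_iInter]
    intro n hn
    exact det_gramMat_ne_zero_of_range_eq_top _ (hm₀ n hn)
  have hlim : Tendsto (fun m => wienerPair (T m)) atTop (𝓝 1) := by
    have h := tendsto_measure_iUnion_atTop (μ := wienerPair) hTmono
    rw [hTuniv, measure_univ] at h
    exact h
  have hlim' : Tendsto (fun m => wienerPair (T m)ᶜ) atTop (𝓝 0) := by
    have h1 : (fun m => wienerPair (T m)ᶜ) = fun m => 1 - wienerPair (T m) :=
      funext fun m => prob_compl_eq_one_sub (hTm m)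
    rw [h1]
    have h2 := ENNReal.Tendsto.sub (tendsto_const_nhds (x := (1 : ℝ≥0∞))) hlim (Or.inl ENNReal.one_ne_top)
    rwa [tsub_self] at h2
  -- the key bound, for every level `m`
  have hbound : ∀ m, wienerPair (Φ ⁻¹' B) ≤ wienerPair (T m)ᶜ := by
    intro m
    have hzero : wienerPair (Φ ⁻¹' B ∩ S m) = 0 := by
      have hset : Φ ⁻¹' B ∩ S m = {wp | (pairSkel m wp, pairRem m wp) ∈
          {p : PairSkeleton m × WienerPair | p ∈ G m ∧ skelFlowMap ω₂ lam β γ N T_L T_R m z p.2 p.1 ∈ B}} := by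
        ext wp
        simp only [Set.mem_inter_iff, Set.mem_preimage, Set.mem_setOf_eq, hΦ, hS]
        rw [pinnedChain_solMap_one_eq_skelFlowMap hω hl hβ hγ N T_L T_R m z wp]
        tauto
      rw [hset]
      refine measure_pairSkel_pairRem_eq_zero_of_volume m ((hGm m).inter
        (hB.preimage (measurable_skelFlowMap hω hl hβ hγ N T_L T_R m z))) fun r => ?_
      exact volume_gramDet_ne_inter_preimage_eq_zero hω hl hβ hγ N T_L T_R m z r hB0
    calc wienerPair (Φ ⁻¹' B) ≤ wienerPair ((Φ ⁻¹' B ∩ S m) ∪ (S m)ᶜ) :=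
          measure_mono fun wp hω => by
            by_cases h : wp ∈ S m
            · exact Or.inl ⟨hω, h⟩
            · exact Or.inr h
      _ ≤ wienerPair (Φ ⁻¹' B ∩ S m) + wienerPair (S m)ᶜ := measure_union_le _ _
      _ = wienerPair (S m)ᶜ := by rw [hzero, zero_add]
      _ ≤ wienerPair (T m)ᶜ := measure_mono (compl_subset_compl.2 (hTS m))
  exact le_antisymm (ge_of_tendsto' hlim' hbound) zero_le

end Assembly

/-- **The named fact `CuneoEckmannHairerReyBellet2018_pinnedChain` follows from H2 alone**
(no Hörmander): `CuneoEckmannHairerReyBellet2018_pinnedChain_of_H2_of_absolutelyContinuous`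
(`LangevinChainNESSFromH2.lean`) fed with the absolute continuity of the transition
probabilities proved above. After this file the fact rests on exactly one named fact, CEHR
Thm 5.1 / Rem 5.2 (`CuneoEckmannHairerReyBellet2018_H2`).
[cite: CuneoEckmannHairerReyBellet2018, Thm 2.13] -/
theorem CuneoEckmannHairerReyBellet2018_pinnedChain_of_H2 (h2 : CuneoEckmannHairerReyBellet2018_H2) :
    CuneoEckmannHairerReyBellet2018_pinnedChain :=
  CuneoEckmannHairerReyBellet2018_pinnedChain_of_H2_of_absolutelyContinuous h2
    fun _ _ _ _ hω hl hβ hγ N T_L T_R hN hL _ z =>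
      pinnedChain_transitionKernel_one_absolutelyContinuous hω hl.le hβ.le hγ.le N T_L T_R hγ hL hN z

end Literature.MathematicalPhysics.KineticTheory.HeatConduction

end
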